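import Summits.QuantumFields.YangMills.Theorems.BalabanUVNodesN15TwoSpacingGluingNeumannKnitEntryTwo
import HarnessLib

/-!
# THE GLUING STEP AT TWO LATTICE SPACINGS, XLVIII: ENTRY 2 OF THE COVER's PARAMETRIX ON THE DOUBLED TORUS, TWO GRIDS — `𝔇(G₀′∇′*_ν, G₀∇*_ν)` HAS THE RATE `(L^k)^{−1∕(8(d+1))}`
# (dag-n15-c g13, FILE 90; N15 = NE2, s1 «background-layer OPERATOR ingredient»)

Cell `pub-ymgap`, seat `pub-ymgap-dag-n15-c` (R134 (a); HUMAN RULING D-0062), generation 13.  `bears_on: R4∕N15 · K3⁷ SpineGivenEndpointR13SepCoPH (stmt-QuantumFields-20544)`.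
Filed `--supports stmt-QuantumFields-20544 --as helper` — COUNT-NEUTRAL.  Theorems only (0 `def`, 0 `sorry`).  Imports BY NAME FILE 89 (through it FILES 83, 84, 80 and dag-n15-a's PROGRAMME
N incl. N-IId∕N-IIg); nothing in the tree is modified.

WHAT.  Doubled torus `M = MP (paramsOf d L (m+1) k hL)`, FILE 70's cover, `E = ∇*_ν` at the coarse spacing `L^{−k}` and the fine spacing `L^{−(k+r)}`, King's pairing `P`, `d ≥ 1`:
★ `entryTwoDefectConst_le` (compression); ★★★ **`hasMaj_idef_parametrix_divAdj_knit`** — `∃ δ D > 0 ∀ m k r ν (k ≥ 1, 4 ≤ L^k): 𝔇(G₀′∘∇′*_ν, G₀∘∇*_ν) ≤ D·(L^k)^{−1∕(8(d+1))}·e^{−δ|y−y′|_T}`: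
FILE 83 `hasMaj_idef_parametrix_comp_cut` with the cut rows N-IIIb (both spacings), the sandwiched entry-2 rows N-IId `hasMaj_chiCube_symOp_gDivAdj_pair` and their defect N-IIg
`hasMaj_idef_chiCube_gDivAdj` (rate `(L^k)^{−1∕(8(d+1))}`), the cut defect N-IIc (rate `(L^k)^{−1∕16} ≤ (L^k)^{−1∕(8(d+1))}` for `d ≥ 1`), FILE 89's sandwiched identity and support, the
Leibniz `mulOp_comp_fgradAdj` at both spacings, the fits FILE 67 `abs_coverH_fine_sub_le`, FILE 84 `abs_coverH_shift_fine_sub_le`, FILE 64 `abs_fgrad_hcube_two_grid_le`.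
FILES 89 + 90 are the entry-2 rows of FILE 50's `GluedLetters` for the glued `U ≡ 1` family (the `G₀∘E` majorant and the `𝔇(G₀′E′, G₀E)` defect).

HONEST FRAMING ∕ LIMITS.  Block-majorant bookkeeping over LANDED rows at `U ≡ 1` on the doubled-cube torus MODEL; no new analytic estimate; nothing of [B5]∕[B6]∕[B9] asserted ([B6]
(2.133)–(2.136) p.247 shapes; [B9] Thm 3.14 pp.426–427 the difference template).  NE2⁺ NOT PRINTED, NOT proved; N15 NOT discharged; counts of record UNMOVED (typed 28∕28 · discharged
5∕27); one finite 𝕋⁴ at fixed ε per index — NOT infinite volume, NOT OS on ℝ⁴, NOT a mass gap, NOT Clay; R4 closes `BalabanLadder.UV` only.  Restate-immune (no Theses import).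
-/

noncomputable section

namespace Summit.QuantumFields.YangMills.BalabanUVNodes.N15.Gluing

open Real
open Literature.MathematicalPhysics.QuantumFieldTheory.Balaban1983to89
open Literature.MathematicalPhysics.QuantumFieldTheory.Balaban1983to89.B5Prop11Plancherel (Tor fine unitVec)
open Literature.MathematicalPhysics.QuantumFieldTheory.Balaban1983to89.B11SectG (BlockNorm HasMaj RowSum)
open Literature.MathematicalPhysics.QuantumFieldTheory.Balaban1983to89.T4EtaRateDefect (idef)
open Literature.MathematicalPhysics.QuantumFieldTheory.Balaban1983to89.T4EtaRateCoeffDefect (pull)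
open Literature.MathematicalPhysics.QuantumFieldTheory.Balaban1983to89.B6Prop26Gluing (mulOp mulOp_apply ind ind_nonneg ind_le_one)
open Literature.MathematicalPhysics.QuantumFieldTheory.Balaban1983to89.B6UnitTorusCarrier (unitTorusGeo triangle254_unitTorusGeo rowSum_unitTorusGeo unitTorusGeo_dist_nonneg)
open Literature.MathematicalPhysics.QuantumFieldTheory.Balaban1983to89.B5SiteBridgeP12 (MP)
open Literature.MathematicalPhysics.QuantumFieldTheory.King1986.Torus (blockOf tdistT tdistT_nonneg)
open Summit.QuantumFields.YangMills.BalabanUVNodes.N15.VectorPiece (bshiftEquiv bshiftEquiv_apply kingPrV blkFine)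
open Summit.QuantumFields.YangMills.BalabanUVNodes.N15.BackgroundLayer (fgrad fgradAdj mulOp_comp_fgradAdj symbOp_sTinv_sub_one_eq)
open Summit.QuantumFields.YangMills.BalabanUVNodes.N15.TwoGrid (paramsOf gOp neumannCubeG symOp symbOp sTinv chiCube cubeBlocks ineq110_114_pair hasMaj_gOp_of_ineq
  hasMaj_chiCube_symOp_comp hasMaj_comp_mulOp_chiInt hasMaj_chiCube_symOp_gDivAdj_pair hasMaj_idef_chiCube_gDivAdj hasMaj_idef_chiCube_neumannCubeG)

variable {d : ℕ}

section TwoGrid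

/-- ★ compression of FILE 83's entry-2 defect constant: `c_s = 1`, `c_d = π∕w ≤ π`, fits `o, o_s, o_d ≤ K·ε₁₆`, `ε₁₆ ≤ ε`, cut defect `m_cε₁₆`, entry-2 defect `m₂ε`. [folklore] -/
theorem entryTwoDefectConst_le {Nov β β₂ cd o os od mc m₂ ε e16 Ko Kos Kod : ℝ} (hNov : 0 ≤ Nov) (hβ : 0 ≤ β) (hβ₂ : 0 ≤ β₂) (hcd : 0 ≤ cd) (hcdπ : cd ≤ π) (hmc : 0 ≤ mc)
    (he : 0 ≤ e16) (heε : e16 ≤ ε) (hKo : 0 ≤ Ko) (hKos : 0 ≤ Kos) (hKod : 0 ≤ Kod) (hoK : o ≤ Ko * e16) (hosK : os ≤ Kos * e16) (hodK : od ≤ Kod * e16) :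
    Nov * ((1 * β₂ * os + 1 * (m₂ * ε) * 1 + o * β₂ * 1) + (1 * β * od + 1 * (mc * e16) * cd + o * β * cd)) ≤
      Nov * ((β₂ * Kos + m₂ + Ko * β₂) + (β * Kod + mc * π + Ko * β * π)) * ε := by
  have hε : 0 ≤ ε := he.trans heε
  have hoε : o ≤ Ko * ε := hoK.trans (mul_le_mul_of_nonneg_left heε hKo)
  have hosε : os ≤ Kos * ε := hosK.trans (mul_le_mul_of_nonneg_left heε hKos)
  have hodε : od ≤ Kod * ε := hodK.trans (mul_le_mul_of_nonneg_left heε hKod)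
  have h1 : 1 * β₂ * os ≤ β₂ * Kos * ε := by nlinarith [mul_le_mul_of_nonneg_left hosε hβ₂]
  have h2 : o * β₂ * 1 ≤ Ko * β₂ * ε := by nlinarith [mul_le_mul_of_nonneg_right hoε hβ₂]
  have h3 : 1 * β * od ≤ β * Kod * ε := by nlinarith [mul_le_mul_of_nonneg_left hodε hβ]
  have h4 : 1 * (mc * e16) * cd ≤ mc * π * ε := by
    have := mul_le_mul (mul_le_mul_of_nonneg_left heε hmc) hcdπ hcd (mul_nonneg hmc hε)
    nlinarith [this]
  have h5 : o * β * cd ≤ Ko * β * π * ε := by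
    have := mul_le_mul (mul_le_mul_of_nonneg_right hoε hβ) hcdπ hcd (mul_nonneg (mul_nonneg hKo hε) hβ)
    nlinarith [this]
  calc Nov * ((1 * β₂ * os + 1 * (m₂ * ε) * 1 + o * β₂ * 1) + (1 * β * od + 1 * (mc * e16) * cd + o * β * cd))
      ≤ Nov * ((β₂ * Kos * ε + m₂ * ε + Ko * β₂ * ε) + (β * Kod * ε + mc * π * ε + Ko * β * π * ε)) := mul_le_mul_of_nonneg_left (by linarith) hNov
    _ = _ := by ring

variable {L : ℕ} [NeZero L]

/-- ★★★ **THE TWO-GRID η-DEFECT OF ENTRY 2 OF THE COVER's PARAMETRIX ON THE DOUBLED TORUS** (`d ≥ 1`): for odd `L ≥ 3`, `a > 0` there are `δ, D > 0` (uniform in `m, k, r, ν`) with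
`𝔇(G₀′∘∇′*_ν, G₀∘∇*_ν) ≤ D·(L^k)^{−1∕(8(d+1))}·e^{−δ|y−y′|_T}` for `k ≥ 1`, `4 ≤ L^k` — FILE 83 `hasMaj_idef_parametrix_comp_cut` with every row a tree theorem.
[cite: Balaban1984PropagatorsII, (2.133), (2.136) p.247 (shapes), (2.36)–(2.37) p.229; Balaban1985BackgroundPropagators, Thm 3.14 pp.426–427 (difference template); King1986, Prop. 3.9
(3.74) p.665 (rate shape)] -/
theorem hasMaj_idef_parametrix_divAdj_knit (hd1 : 1 ≤ d) (hL : Odd L ∧ 1 < L) {a : ℝ} (ha : 0 < a) :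
    ∃ δ D : ℝ, 0 < δ ∧ 0 < D ∧ ∀ (m kk r : ℕ) (_hk : 1 ≤ kk) (_hn4 : 4 ≤ L ^ kk) (ν : Fin (d + 1)),
      HasMaj (BlockNorm.ofBlocks (unitTorusGeo L kk (MP (paramsOf d L (m + 1) kk hL)))
          (fun b : Tor (fine (L ^ kk) (MP (paramsOf d L (m + 1) kk hL))) × Fin (d + 1) => blockOf (L ^ kk) (MP (paramsOf d L (m + 1) kk hL)) b.1))
        (BlockNorm.ofBlocks (unitTorusGeo L kk (MP (paramsOf d L (m + 1) kk hL)))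
          (fun i : Tor (fine (L ^ r * L ^ kk) (MP (paramsOf d L (m + 1) kk hL))) × Fin (d + 1) => blockOf (L ^ r * L ^ kk) (MP (paramsOf d L (m + 1) kk hL)) i.1))
        (idef (pull (kingPrV L kk r (MP (paramsOf d L (m + 1) kk hL)))) (pull (kingPrV L kk r (MP (paramsOf d L (m + 1) kk hL))))
          (parametrix (knitH d L m kk (L ^ r * L ^ kk) hL) (knitG d L m kk (L ^ r * L ^ kk) hL a) ∘ₗ
            fgradAdj ((L ^ r * L ^ kk : ℕ) : ℝ) (bshiftEquiv (MP (paramsOf d L (m + 1) kk hL)) (L ^ r * L ^ kk) ν))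
          (parametrix (knitH d L m kk (L ^ kk) hL) (knitG d L m kk (L ^ kk) hL a) ∘ₗ fgradAdj ((L ^ kk : ℕ) : ℝ) (bshiftEquiv (MP (paramsOf d L (m + 1) kk hL)) (L ^ kk) ν)))
        (fun y y' => D * ((L ^ kk : ℕ) : ℝ) ^ (-(1 / (8 * ((d : ℝ) + 1)))) * Real.exp (-(δ * tdistT (MP (paramsOf d L (m + 1) kk hL)) y y'))) := by
  have hL3 : 3 ≤ L := by obtain ⟨⟨j, hj⟩, h1⟩ := hL; omega
  have hLpos : 0 < L := by omega
  have hL1 : 1 ≤ L := hLpos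
  have hLodd : Odd L := hL.1
  have hL2 : 2 ≤ L := hL.2
  obtain ⟨δ₀, C, Cα, Cε, Cαε, hδ₀, hC, H⟩ := ineq110_114_pair (d := d) hL ha
  obtain ⟨δT, βT, hδT, hβT, HT⟩ := hasMaj_chiCube_symOp_gDivAdj_pair (d := d) hL ha
  obtain ⟨δc, mc, hδc, hmc, HC⟩ := hasMaj_idef_chiCube_neumannCubeG (d := d) hLodd hL2 ha (γ := 1 / 8) (by norm_num) (by norm_num)
  obtain ⟨δ2, m2, hδ2, hm2, H2⟩ := hasMaj_idef_chiCube_gDivAdj (d := d) hLodd hL2 ha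
  set δ : ℝ := min (min δ₀ δT) (min δc δ2) with hδ_def
  have hδ : 0 < δ := lt_min (lt_min hδ₀ hδT) (lt_min hδc hδ2)
  have hd0 : δ ≤ δ₀ := (min_le_left _ _).trans (min_le_left _ _)
  have hdT : δ ≤ δT := (min_le_left _ _).trans (min_le_right _ _)
  have hdc : δ ≤ δc := (min_le_right _ _).trans (min_le_left _ _)
  have hd2 : δ ≤ δ2 := (min_le_right _ _).trans (min_le_right _ _)
  set β : ℝ := 2 ^ (d + 1) * (C * Real.exp δ₀) with hβ_def
  have hβ : 0 ≤ β := by positivity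
  set Nov : ℝ := (((2 * L) ^ (d + 1) : ℕ) : ℝ) with hNov_def
  set Ko : ℝ := π * (d + 1) with hKo_def
  set Kos : ℝ := π * (d + 1) + π + π with hKos_def
  set Kod : ℝ := 64 * π ^ 2 + π ^ 2 * (d + 1 : ℕ) with hKod_def
  set D : ℝ := Nov * ((βT * Kos + m2 + Ko * βT) + (β * Kod + mc * π + Ko * β * π)) + 1 with hD_def
  refine ⟨δ, D, hδ, by positivity, fun m kk r hk hn4 ν => ?_⟩
  set M : Fin (d + 1) → ℕ := MP (paramsOf d L (m + 1) kk hL) with hMdef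
  have hM : ∀ μ, M μ = 2 * L * L ^ m := MP_succ_eq L m kk hL
  have hM' : ∀ μ, M μ = 2 * (L * L ^ m) := fun μ => by rw [hM μ, mul_assoc]
  have hw : 0 < L ^ m := pow_pos hLpos m
  have hn : 1 ≤ L ^ kk := Nat.one_le_pow _ _ hLpos
  have hn' : 1 ≤ L ^ r * L ^ kk := Nat.one_le_iff_ne_zero.mpr (Nat.mul_ne_zero (pow_ne_zero r (NeZero.ne L)) (pow_ne_zero kk (NeZero.ne L)))
  have hfit := coverMargin_fit hL3 m
  have hfit1 : coverMargin L m + 2 * L ^ m + 1 ≤ L * L ^ m := by omega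
  have hS : L * L ^ m ≤ 2 * L * L ^ m := by rw [mul_assoc]; omega
  have hSe : L ^ (m + 1) = L * L ^ m := by rw [pow_succ, mul_comm]
  have h3 : 3 ≤ L ^ kk * L ^ m :=
    calc 3 ≤ L := hL3
      _ = L ^ 1 := (pow_one L).symm
      _ ≤ L ^ kk := Nat.pow_le_pow_right hLpos hk
      _ = L ^ kk * 1 := (mul_one _).symm
      _ ≤ L ^ kk * L ^ m := Nat.mul_le_mul_left _ hw
  have hwR : (1 : ℝ) ≤ ((L ^ m : ℕ) : ℝ) := by exact_mod_cast hw
  have hnR : (1 : ℝ) ≤ ((L ^ kk : ℕ) : ℝ) := by exact_mod_cast hn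
  have hnn' : ((L ^ kk : ℕ) : ℝ) ≤ ((L ^ r * L ^ kk : ℕ) : ℝ) := by exact_mod_cast Nat.le_mul_of_pos_left (L ^ kk) (pow_pos hLpos r)
  set e16 : ℝ := ((L ^ kk : ℕ) : ℝ) ^ (-(1 / 16 : ℝ)) with he16_def
  set ε : ℝ := ((L ^ kk : ℕ) : ℝ) ^ (-(1 / (8 * ((d : ℝ) + 1)))) with hε_def
  obtain ⟨hnε, hnwε, hw1, hε0⟩ := rpow_sixteenth_facts hnR hwR
  have hε2 : 0 ≤ ε := Real.rpow_nonneg (by positivity) _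
  have hd1R : (1 : ℝ) ≤ d := by exact_mod_cast hd1
  have heε : e16 ≤ ε := by
    refine Real.rpow_le_rpow_of_exponent_le hnR ?_
    have hpos : (0 : ℝ) < 8 * ((d : ℝ) + 1) := by positivity
    rw [neg_le_neg_iff, div_le_div_iff₀ hpos (by norm_num : (0 : ℝ) < 16)]
    nlinarith
  have hexp16 : (-((1 : ℝ) / 8 / 2)) = -(1 / 16 : ℝ) := by norm_num
  have hblk : (fun i : Tor (fine (L ^ r * L ^ kk) M) × Fin (d + 1) => blockOf (L ^ r * L ^ kk) M i.1) =
      (fun b : Tor (fine (L ^ kk) M) × Fin (d + 1) => blockOf (L ^ kk) M b.1) ∘ kingPrV L kk r M := (VectorPiece.blkFine_comp_kingPrV (M := M) L kk r).symm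
  have hind : ∀ (k : Fin (d + 1) → ZMod (2 * L)) (y y' : Tor M),
      0 ≤ ind (g := unitTorusGeo L kk M) ((cubeBlocks M (coverCorner M (L ^ m) L (coverMargin L m) k) (L * L ^ m) : Finset (Tor M)) : Set (Tor M)) y *
        ind (g := unitTorusGeo L kk M) ((cubeBlocks M (coverCorner M (L ^ m) L (coverMargin L m) k) (L * L ^ m) : Finset (Tor M)) : Set (Tor M)) y' :=
    fun k y y' => mul_nonneg (ind_nonneg _ _) (ind_nonneg _ _)
  -- cut rows at both spacings
  have hG := hasMaj_gOp_of_ineq (L := L) (k := kk) M (L ^ kk) a hn (H (m + 1) kk r hk).1 hC.le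
  have hG' := hasMaj_gOp_of_ineq (L := L) (k := kk) M (L ^ r * L ^ kk) a hn' (H (m + 1) kk r hk).2 hC.le
  have hGc : ∀ k : Fin (d + 1) → ZMod (2 * L),
      HasMaj (BlockNorm.ofBlocks (unitTorusGeo L kk M) (fun b : Tor (fine (L ^ kk) M) × Fin (d + 1) => blockOf (L ^ kk) M b.1))
        (BlockNorm.ofBlocks (unitTorusGeo L kk M) (fun b : Tor (fine (L ^ kk) M) × Fin (d + 1) => blockOf (L ^ kk) M b.1))
        (mulOp (chiCube M (L ^ kk) (coverCorner M (L ^ m) L (coverMargin L m) k) (L * L ^ m)) ∘ₗ knitG d L m kk (L ^ kk) hL a k)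
        (fun y y' => ind ((cubeBlocks M (coverCorner M (L ^ m) L (coverMargin L m) k) (L * L ^ m) : Finset (Tor M)) : Set (Tor M)) y *
          ind ((cubeBlocks M (coverCorner M (L ^ m) L (coverMargin L m) k) (L * L ^ m) : Finset (Tor M)) : Set (Tor M)) y' * (β * Real.exp (-(δ * tdistT M y y')))) := fun k =>
    hasMaj_rate_le (hind k) hβ hd0
      (hasMaj_chiCube_symOp_comp (L := L) (k := kk) (c := coverCorner M (L ^ m) L (coverMargin L m) k) (S := L * L ^ m) hC.le hδ₀.le hM'
        (hasMaj_comp_mulOp_chiInt (c := coverCorner M (L ^ m) L (coverMargin L m) k) (S := L * L ^ m) hC.le hG))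
  have hGc' : ∀ k : Fin (d + 1) → ZMod (2 * L),
      HasMaj (BlockNorm.ofBlocks (unitTorusGeo L kk M) ((fun b : Tor (fine (L ^ kk) M) × Fin (d + 1) => blockOf (L ^ kk) M b.1) ∘ kingPrV L kk r M))
        (BlockNorm.ofBlocks (unitTorusGeo L kk M) ((fun b : Tor (fine (L ^ kk) M) × Fin (d + 1) => blockOf (L ^ kk) M b.1) ∘ kingPrV L kk r M))
        (mulOp (chiCube M (L ^ r * L ^ kk) (coverCorner M (L ^ m) L (coverMargin L m) k) (L * L ^ m)) ∘ₗ knitG d L m kk (L ^ r * L ^ kk) hL a k)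
        (fun y y' => ind ((cubeBlocks M (coverCorner M (L ^ m) L (coverMargin L m) k) (L * L ^ m) : Finset (Tor M)) : Set (Tor M)) y *
          ind ((cubeBlocks M (coverCorner M (L ^ m) L (coverMargin L m) k) (L * L ^ m) : Finset (Tor M)) : Set (Tor M)) y' * (β * Real.exp (-(δ * tdistT M y y')))) := fun k => by
    rw [← hblk]
    exact hasMaj_rate_le (hind k) hβ hd0
      (hasMaj_chiCube_symOp_comp (L := L) (k := kk) (c := coverCorner M (L ^ m) L (coverMargin L m) k) (S := L * L ^ m) hC.le hδ₀.le hM'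
        (hasMaj_comp_mulOp_chiInt (c := coverCorner M (L ^ m) L (coverMargin L m) k) (S := L * L ^ m) hC.le hG'))
  -- sandwiched entry-2 rows at both spacings
  have hT2 : ∀ k : Fin (d + 1) → ZMod (2 * L),
      HasMaj (BlockNorm.ofBlocks (unitTorusGeo L kk M) (fun b : Tor (fine (L ^ kk) M) × Fin (d + 1) => blockOf (L ^ kk) M b.1))
        (BlockNorm.ofBlocks (unitTorusGeo L kk M) (fun b : Tor (fine (L ^ kk) M) × Fin (d + 1) => blockOf (L ^ kk) M b.1))
        (mulOp (chiCube M (L ^ kk) (coverCorner M (L ^ m) L (coverMargin L m) k) (L * L ^ m)) ∘ₗ symOp M (L ^ kk) (coverCorner M (L ^ m) L (coverMargin L m) k) ∘ₗ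
          (gOp M (L ^ kk) a ∘ₗ fgradAdj ((L ^ kk : ℕ) : ℝ) (bshiftEquiv M (L ^ kk) ν)) ∘ₗ mulOp (chiCube M (L ^ kk) (coverCorner M (L ^ m) L (coverMargin L m) k) (L * L ^ m)))
        (fun y y' => ind ((cubeBlocks M (coverCorner M (L ^ m) L (coverMargin L m) k) (L * L ^ m) : Finset (Tor M)) : Set (Tor M)) y *
          ind ((cubeBlocks M (coverCorner M (L ^ m) L (coverMargin L m) k) (L * L ^ m) : Finset (Tor M)) : Set (Tor M)) y' * (βT * Real.exp (-(δ * tdistT M y y')))) := fun k => by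
    have h := (HT (m + 1) kk r hk (coverCorner M (L ^ m) L (coverMargin L m) k) ν).1
    rw [hSe, symbOp_sTinv_sub_one_eq] at h
    exact hasMaj_rate_le (hind k) hβT.le hdT h
  have hT2' : ∀ k : Fin (d + 1) → ZMod (2 * L),
      HasMaj (BlockNorm.ofBlocks (unitTorusGeo L kk M) ((fun b : Tor (fine (L ^ kk) M) × Fin (d + 1) => blockOf (L ^ kk) M b.1) ∘ kingPrV L kk r M))
        (BlockNorm.ofBlocks (unitTorusGeo L kk M) ((fun b : Tor (fine (L ^ kk) M) × Fin (d + 1) => blockOf (L ^ kk) M b.1) ∘ kingPrV L kk r M))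
        (mulOp (chiCube M (L ^ r * L ^ kk) (coverCorner M (L ^ m) L (coverMargin L m) k) (L * L ^ m)) ∘ₗ symOp M (L ^ r * L ^ kk) (coverCorner M (L ^ m) L (coverMargin L m) k) ∘ₗ
          (gOp M (L ^ r * L ^ kk) a ∘ₗ fgradAdj ((L ^ r * L ^ kk : ℕ) : ℝ) (bshiftEquiv M (L ^ r * L ^ kk) ν)) ∘ₗ
            mulOp (chiCube M (L ^ r * L ^ kk) (coverCorner M (L ^ m) L (coverMargin L m) k) (L * L ^ m)))
        (fun y y' => ind ((cubeBlocks M (coverCorner M (L ^ m) L (coverMargin L m) k) (L * L ^ m) : Finset (Tor M)) : Set (Tor M)) y *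
          ind ((cubeBlocks M (coverCorner M (L ^ m) L (coverMargin L m) k) (L * L ^ m) : Finset (Tor M)) : Set (Tor M)) y' * (βT * Real.exp (-(δ * tdistT M y y')))) := fun k => by
    have h := (HT (m + 1) kk r hk (coverCorner M (L ^ m) L (coverMargin L m) k) ν).2
    rw [hSe, symbOp_sTinv_sub_one_eq] at h
    rw [← hblk]
    exact hasMaj_rate_le (hind k) hβT.le hdT h
  -- defects: cut (N-IIc) and entry 2 (N-IIg)
  have hIGc : ∀ k : Fin (d + 1) → ZMod (2 * L),
      HasMaj (BlockNorm.ofBlocks (unitTorusGeo L kk M) (fun b : Tor (fine (L ^ kk) M) × Fin (d + 1) => blockOf (L ^ kk) M b.1))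
        (BlockNorm.ofBlocks (unitTorusGeo L kk M) ((fun b : Tor (fine (L ^ kk) M) × Fin (d + 1) => blockOf (L ^ kk) M b.1) ∘ kingPrV L kk r M))
        (idef (pull (kingPrV L kk r M)) (pull (kingPrV L kk r M))
          (mulOp (chiCube M (L ^ r * L ^ kk) (coverCorner M (L ^ m) L (coverMargin L m) k) (L * L ^ m)) ∘ₗ knitG d L m kk (L ^ r * L ^ kk) hL a k)
          (mulOp (chiCube M (L ^ kk) (coverCorner M (L ^ m) L (coverMargin L m) k) (L * L ^ m)) ∘ₗ knitG d L m kk (L ^ kk) hL a k))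
        (fun y y' => ind ((cubeBlocks M (coverCorner M (L ^ m) L (coverMargin L m) k) (L * L ^ m) : Finset (Tor M)) : Set (Tor M)) y *
          ind ((cubeBlocks M (coverCorner M (L ^ m) L (coverMargin L m) k) (L * L ^ m) : Finset (Tor M)) : Set (Tor M)) y' * (mc * e16 * Real.exp (-(δ * tdistT M y y')))) := fun k => by
    have h := HC (m + 1) kk r hk hL (coverCorner M (L ^ m) L (coverMargin L m) k)
    rw [hSe, hexp16] at h
    have h2 := hasMaj_rate_le (hind k) (by positivity : 0 ≤ mc * e16) hdc h
    rw [hblk] at h2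
    exact h2
  have hIT2 : ∀ k : Fin (d + 1) → ZMod (2 * L),
      HasMaj (BlockNorm.ofBlocks (unitTorusGeo L kk M) (fun b : Tor (fine (L ^ kk) M) × Fin (d + 1) => blockOf (L ^ kk) M b.1))
        (BlockNorm.ofBlocks (unitTorusGeo L kk M) ((fun b : Tor (fine (L ^ kk) M) × Fin (d + 1) => blockOf (L ^ kk) M b.1) ∘ kingPrV L kk r M))
        (idef (pull (kingPrV L kk r M)) (pull (kingPrV L kk r M))
          (mulOp (chiCube M (L ^ r * L ^ kk) (coverCorner M (L ^ m) L (coverMargin L m) k) (L * L ^ m)) ∘ₗ symOp M (L ^ r * L ^ kk) (coverCorner M (L ^ m) L (coverMargin L m) k) ∘ₗ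
            (gOp M (L ^ r * L ^ kk) a ∘ₗ fgradAdj ((L ^ r * L ^ kk : ℕ) : ℝ) (bshiftEquiv M (L ^ r * L ^ kk) ν)) ∘ₗ
              mulOp (chiCube M (L ^ r * L ^ kk) (coverCorner M (L ^ m) L (coverMargin L m) k) (L * L ^ m)))
          (mulOp (chiCube M (L ^ kk) (coverCorner M (L ^ m) L (coverMargin L m) k) (L * L ^ m)) ∘ₗ symOp M (L ^ kk) (coverCorner M (L ^ m) L (coverMargin L m) k) ∘ₗ
            (gOp M (L ^ kk) a ∘ₗ fgradAdj ((L ^ kk : ℕ) : ℝ) (bshiftEquiv M (L ^ kk) ν)) ∘ₗ mulOp (chiCube M (L ^ kk) (coverCorner M (L ^ m) L (coverMargin L m) k) (L * L ^ m))))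
        (fun y y' => ind ((cubeBlocks M (coverCorner M (L ^ m) L (coverMargin L m) k) (L * L ^ m) : Finset (Tor M)) : Set (Tor M)) y *
          ind ((cubeBlocks M (coverCorner M (L ^ m) L (coverMargin L m) k) (L * L ^ m) : Finset (Tor M)) : Set (Tor M)) y' * (m2 * ε * Real.exp (-(δ * tdistT M y y')))) := fun k => by
    have h := H2 (m + 1) kk r hk hn4 hL (coverCorner M (L ^ m) L (coverMargin L m) k) ν
    rw [hSe, symbOp_sTinv_sub_one_eq, symbOp_sTinv_sub_one_eq] at h
    have h2 := hasMaj_rate_le (hind k) (by positivity : 0 ≤ m2 * ε) hd2 h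
    rw [hblk] at h2
    exact h2
  -- the partition: Leibniz, cuts, sandwiched identities, sizes, fits, overlap
  have hχ := fun μ k => chiCube_coverCorner_eq_one_side (M := M) (n := L ^ kk) (m₀ := coverMargin L m) hM hw hfit1 hS μ k
  have hχ' := fun μ k => chiCube_coverCorner_eq_one_side (M := M) (n := L ^ r * L ^ kk) (m₀ := coverMargin L m) hM hw hfit1 hS μ k
  have hleib : ∀ k : Fin (d + 1) → ZMod (2 * L), mulOp (knitH d L m kk (L ^ kk) hL k) ∘ₗ fgradAdj ((L ^ kk : ℕ) : ℝ) (bshiftEquiv M (L ^ kk) ν) =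
      fgradAdj ((L ^ kk : ℕ) : ℝ) (bshiftEquiv M (L ^ kk) ν) ∘ₗ mulOp (knitH d L m kk (L ^ kk) hL k ∘ ⇑(bshiftEquiv M (L ^ kk) ν)) +
        mulOp (fgrad ((L ^ kk : ℕ) : ℝ) (bshiftEquiv M (L ^ kk) ν) (knitH d L m kk (L ^ kk) hL k)) := fun k => mulOp_comp_fgradAdj _ _ _
  have hleib' : ∀ k : Fin (d + 1) → ZMod (2 * L), mulOp (knitH d L m kk (L ^ r * L ^ kk) hL k) ∘ₗ fgradAdj ((L ^ r * L ^ kk : ℕ) : ℝ) (bshiftEquiv M (L ^ r * L ^ kk) ν) =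
      fgradAdj ((L ^ r * L ^ kk : ℕ) : ℝ) (bshiftEquiv M (L ^ r * L ^ kk) ν) ∘ₗ mulOp (knitH d L m kk (L ^ r * L ^ kk) hL k ∘ ⇑(bshiftEquiv M (L ^ r * L ^ kk) ν)) +
        mulOp (fgrad ((L ^ r * L ^ kk : ℕ) : ℝ) (bshiftEquiv M (L ^ r * L ^ kk) ν) (knitH d L m kk (L ^ r * L ^ kk) hL k)) := fun k => mulOp_comp_fgradAdj _ _ _
  have hcut : ∀ k : Fin (d + 1) → ZMod (2 * L), mulOp (knitH d L m kk (L ^ kk) hL k) ∘ₗ mulOp (chiCube M (L ^ kk) (coverCorner M (L ^ m) L (coverMargin L m) k) (L * L ^ m)) =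
      mulOp (knitH d L m kk (L ^ kk) hL k) := fun k => hcube_cut (2 * L) (coverXi M (L ^ kk) (L ^ m)) (bshiftEquiv M (L ^ kk)) 0 (hχ 0 k)
  have hcut' : ∀ k : Fin (d + 1) → ZMod (2 * L), mulOp (knitH d L m kk (L ^ r * L ^ kk) hL k) ∘ₗ mulOp (chiCube M (L ^ r * L ^ kk) (coverCorner M (L ^ m) L (coverMargin L m) k) (L * L ^ m)) =
      mulOp (knitH d L m kk (L ^ r * L ^ kk) hL k) := fun k => hcube_cut (2 * L) (coverXi M (L ^ r * L ^ kk) (L ^ m)) (bshiftEquiv M (L ^ r * L ^ kk)) 0 (hχ' 0 k)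
  have hE2 := fun k : Fin (d + 1) → ZMod (2 * L) => knitG_comp_divAdj_sandwich (n := L ^ kk) (m₀ := coverMargin L m) hM hM' hw hfit1 hS ha ν k
  have hE2' := fun k : Fin (d + 1) → ZMod (2 * L) => knitG_comp_divAdj_sandwich (n := L ^ r * L ^ kk) (m₀ := coverMargin L m) hM hM' hw hfit1 hS ha ν k
  have hh' : ∀ (k : Fin (d + 1) → ZMod (2 * L)) x', |knitH d L m kk (L ^ r * L ^ kk) hL k x'| ≤ 1 := fun k x' => abs_coverH_le_one k x'
  have hhs : ∀ (k : Fin (d + 1) → ZMod (2 * L)) x, |(knitH d L m kk (L ^ kk) hL k ∘ ⇑(bshiftEquiv M (L ^ kk) ν)) x| ≤ 1 := fun k x => abs_coverH_le_one k (bshiftEquiv M (L ^ kk) ν x)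
  have hdh : ∀ (k : Fin (d + 1) → ZMod (2 * L)) x, |fgrad ((L ^ kk : ℕ) : ℝ) (bshiftEquiv M (L ^ kk) ν) (knitH d L m kk (L ^ kk) hL k) x| ≤ π / ((L ^ m : ℕ) : ℝ) :=
    fun k x => abs_fgrad_coverH_le hM hw k ν x
  have hfitH : ∀ (k : Fin (d + 1) → ZMod (2 * L)) x', |knitH d L m kk (L ^ r * L ^ kk) hL k x' - knitH d L m kk (L ^ kk) hL k (kingPrV L kk r M x')| ≤
      π * (d + 1) / (((L ^ kk : ℕ) : ℝ) * ((L ^ m : ℕ) : ℝ)) := fun k x' => abs_coverH_fine_sub_le (L := L) (kk := kk) (r := r) hM hw k x'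
  have hfits : ∀ (k : Fin (d + 1) → ZMod (2 * L)) x', |(knitH d L m kk (L ^ r * L ^ kk) hL k ∘ ⇑(bshiftEquiv M (L ^ r * L ^ kk) ν)) x' -
      (knitH d L m kk (L ^ kk) hL k ∘ ⇑(bshiftEquiv M (L ^ kk) ν)) (kingPrV L kk r M x')| ≤
      π * (d + 1) / (((L ^ kk : ℕ) : ℝ) * ((L ^ m : ℕ) : ℝ)) + π / ((L ^ m : ℕ) : ℝ) / ((L ^ r * L ^ kk : ℕ) : ℝ) + π / ((L ^ m : ℕ) : ℝ) / ((L ^ kk : ℕ) : ℝ) :=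
    fun k x' => abs_coverH_shift_fine_sub_le (L := L) (kk := kk) (r := r) hM hw k ν x'
  obtain ⟨hs0, hs13, hs1', hs1, hsL, hnκ, hnκ'⟩ := coverFit_params (L := L) (kk := kk) (r := r) (w := L ^ m) hL1 hw h3
  have hξ := fun μ μ' b => coverXi_shift (n := L ^ kk) hM hw μ μ' b
  have hξ' := fun μ μ' b => coverXi_shift (n := L ^ r * L ^ kk) hM hw μ μ' b
  have hoff := fun μ x' => coverXi_offset (M := M) (L := L) (kk := kk) (r := r) (w := L ^ m) (q := L) μ x'
  have hK2 : 2 ≤ 2 * L := by omega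
  have hLr : 1 ≤ L ^ r := Nat.one_le_pow _ _ hLpos
  have hfitd : ∀ (k : Fin (d + 1) → ZMod (2 * L)) x', |fgrad ((L ^ r * L ^ kk : ℕ) : ℝ) (bshiftEquiv M (L ^ r * L ^ kk) ν) (knitH d L m kk (L ^ r * L ^ kk) hL k) x' -
      fgrad ((L ^ kk : ℕ) : ℝ) (bshiftEquiv M (L ^ kk) ν) (knitH d L m kk (L ^ kk) hL k) (kingPrV L kk r M x')| ≤
      |((((L ^ m : ℕ) : ℝ)))⁻¹| * (((L ^ kk : ℕ) : ℝ) * ((L ^ m : ℕ) : ℝ))⁻¹ * (64 * π ^ 2 + π ^ 2 * Fintype.card (Fin (d + 1))) := fun k x' =>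
    abs_fgrad_hcube_two_grid_le (2 * L) (coverXi M (L ^ kk) (L ^ m)) (coverXi M (L ^ r * L ^ kk) (L ^ m)) (kingPrV L kk r M) (bshiftEquiv M (L ^ kk))
      (bshiftEquiv M (L ^ r * L ^ kk)) hK2 hLr hs0 hs1' hsL hnκ hnκ' hξ hξ' hoff k ν x'
  have hN := fun y => sum_ind_cubeBlocks_le (M := M) (w := L ^ m) (q := L) (m₀ := coverMargin L m) L kk y
  -- FILE 83
  have key := hasMaj_idef_parametrix_comp_cut (g := unitTorusGeo L kk M) (fun b : Tor (fine (L ^ kk) M) × Fin (d + 1) => blockOf (L ^ kk) M b.1) (kingPrV L kk r M)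
    (fun k => ((cubeBlocks M (coverCorner M (L ^ m) L (coverMargin L m) k) (L * L ^ m) : Finset (Tor M)) : Set (Tor M)))
    (E := fgradAdj ((L ^ kk : ℕ) : ℝ) (bshiftEquiv M (L ^ kk) ν)) (E' := fgradAdj ((L ^ r * L ^ kk : ℕ) : ℝ) (bshiftEquiv M (L ^ r * L ^ kk) ν))
    (G := knitG d L m kk (L ^ kk) hL a) (G' := knitG d L m kk (L ^ r * L ^ kk) hL a)
    hβ hβT.le zero_le_one (by positivity : (0 : ℝ) ≤ π / ((L ^ m : ℕ) : ℝ)) (by positivity) (by positivity) (by positivity) (by positivity : 0 ≤ mc * e16)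
    (by positivity : 0 ≤ m2 * ε) hleib hleib' hcut hcut' hE2 hE2' hh' hhs hdh hfitH hfits hfitd hN hGc hGc' hT2 hT2' hIGc hIT2
  rw [← hblk] at key
  refine key.mono fun y y' => mul_le_mul_of_nonneg_right ?_ (Real.exp_nonneg _)
  -- the compression
  clear key hIT2 hIGc hT2' hT2 hGc' hGc hG hG' hleib hleib' hcut hcut' hE2 hE2' hh' hhs hdh hfitH hfits hfitd hN hξ hξ' hoff hχ hχ' H HT HC H2 hblk hind
  rw [Fintype.card_fin]
  have hwpos : (0 : ℝ) < ((L ^ m : ℕ) : ℝ) := by linarith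
  have hnpos : (0 : ℝ) < ((L ^ kk : ℕ) : ℝ) := by linarith
  have hcdπ : π / ((L ^ m : ℕ) : ℝ) ≤ π := div_le_self Real.pi_pos.le hwR
  have ho : π * (d + 1) / (((L ^ kk : ℕ) : ℝ) * ((L ^ m : ℕ) : ℝ)) ≤ Ko * e16 := by
    rw [div_eq_mul_inv]; exact mul_le_mul_of_nonneg_left hnwε (by positivity)
  have hπw : π / ((L ^ m : ℕ) : ℝ) / ((L ^ kk : ℕ) : ℝ) ≤ π * e16 := by
    rw [div_div, div_eq_mul_inv, mul_comm ((L ^ m : ℕ) : ℝ)]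
    exact mul_le_mul_of_nonneg_left hnwε Real.pi_pos.le
  have hπw' : π / ((L ^ m : ℕ) : ℝ) / ((L ^ r * L ^ kk : ℕ) : ℝ) ≤ π * e16 :=
    le_trans (div_le_div_of_nonneg_left (by positivity) hnpos hnn') hπw
  have hos : π * (d + 1) / (((L ^ kk : ℕ) : ℝ) * ((L ^ m : ℕ) : ℝ)) + π / ((L ^ m : ℕ) : ℝ) / ((L ^ r * L ^ kk : ℕ) : ℝ) + π / ((L ^ m : ℕ) : ℝ) / ((L ^ kk : ℕ) : ℝ) ≤
      Kos * e16 := by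
    calc _ ≤ Ko * e16 + π * e16 + π * e16 := add_le_add (add_le_add ho hπw') hπw
      _ = Kos * e16 := by rw [hKos_def, hKo_def]; ring
  have hod : |((((L ^ m : ℕ) : ℝ)))⁻¹| * (((L ^ kk : ℕ) : ℝ) * ((L ^ m : ℕ) : ℝ))⁻¹ * (64 * π ^ 2 + π ^ 2 * (d + 1 : ℕ)) ≤ Kod * e16 := by
    rw [abs_of_pos (inv_pos.mpr hwpos)]
    have t : (((L ^ m : ℕ) : ℝ))⁻¹ * (((L ^ kk : ℕ) : ℝ) * ((L ^ m : ℕ) : ℝ))⁻¹ ≤ 1 * e16 := mul_le_mul hw1 hnwε (by positivity) zero_le_one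
    rw [one_mul] at t
    calc (((L ^ m : ℕ) : ℝ))⁻¹ * (((L ^ kk : ℕ) : ℝ) * ((L ^ m : ℕ) : ℝ))⁻¹ * (64 * π ^ 2 + π ^ 2 * (d + 1 : ℕ))
        ≤ e16 * (64 * π ^ 2 + π ^ 2 * (d + 1 : ℕ)) := mul_le_mul_of_nonneg_right t (by positivity)
      _ = Kod * e16 := by rw [hKod_def]; ring
  have hcomp := entryTwoDefectConst_le (m₂ := m2) (by positivity : 0 ≤ Nov) hβ hβT.le (by positivity : (0 : ℝ) ≤ π / ((L ^ m : ℕ) : ℝ)) hcdπ hmc.le hε0 heε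
    (by positivity) (by positivity) (by positivity) ho hos hod
  refine hcomp.trans ?_
  rw [hD_def, add_mul _ (1 : ℝ) ε, one_mul]
  exact le_add_of_nonneg_right hε2

end TwoGrid

end Summit.QuantumFields.YangMills.BalabanUVNodes.N15.Gluing

end
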